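/-
Copyright (c) 2026 the pub-hodgecm-mathlib formalisation cell (harness21).  Prover seat hodgecm-mathlib-F0P2-p01 (g11), programme P2,
row B⁗ «THETA PAIRS: THE NON-ARCHIMEDEAN CONJUNCTS OF `holCotForms` ARE FREE» for the desk's OCC♭-GEN line (stub Θ-OCC-GEN
`StubThetaOccursInGen`), 2026-09-01.  KERNEL module: THEOREMS ONLY (no definition, no named fact, no `sorry`, no instance, no notation).
-/
import Summits.HodgeConjecture.HodgeConjecture.Theorems.F0P2sThetaOccursInOfPairs   -- ★ B‴ parts 1–2 (theta intertwiner in function currency)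
import Summits.HodgeConjecture.HodgeConjecture.Theorems.F0P2cStubCI                -- ★ `rhoAtLine_chi_isSmoothRep` (ω_H smooth at the pinned frame)
import Literature.NumberTheory.Automorphic.UnitaryGroupCohomologicalFormsSmooth    -- ★ `smoothFun`, `conjFun_mem_smoothFun`
import Literature.NumberTheory.Automorphic.UnitaryGroupCotangentSpectralProjectionConj  -- ★ `conjFun_conjFun` (+ `cmArchSection`, `cmCompactFactor`)
import Summits.HodgeConjecture.HodgeConjecture.Theorems.H413SpectrumJunction       -- ★ `quotientSubgroup_adelicGroupData`
import HarnessLib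

/-!
# FLOOR-0 P2 · B⁗ «THETA PAIRS: LEFT-INVARIANCE AND FINITE-ADELIC SMOOTHNESS ARE FREE» — Θ-OCC-GEN's `∃ θ`-clause with values in
# `holCotForms` ∕ its conjugate from PURELY ARCHIMEDEAN conditions on the theta pairs (+ one non-vanishing)

Cell hodgecm-mathlib (D-0151), FLOOR 0; crux item H413 = stmt-HodgeConjecture-24833 (route `HCCMUnconditional`, no route verbs); programme P2, the
OCC♭-GEN pay-down line of OCC♭∀ (books #155′; desk F0P2-plan (g12) ED. 1, ONE letter Θ-OCC-GEN `StubThetaOccursInGen` in function currency: «∃ θ :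
omegaAtLine … a χ →ₗ[ℂ] (U(H)(𝔸_{L⁺}) → ℂ²), θ ≠ 0, values in `cohForms (cmArchSection, cmCompactFactor)`, `θ (ρ(a,χ) k w) = fun x ↦ θ w (x * k_𝔸)`»).
Sequel of ★ `Theorems/F0P2sThetaFunIntertwiner` + ★ `Theorems/F0P2sThetaOccursInOfPairs` (the intertwiner `θ_φ` with `θ_φ (mk Φ_f)` = the theta pair
`fun x j ↦ Θ̃_{R_e E(φ_j ⊗ Φ_f)}(charCM χ̃_χ)(ιA x)`, and the `∃ θ`-clause from (T∀) «every theta pair ∈ A» + (N) «one theta pair ≠ 0»).  THIS FILE removes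
from (T∀) everything that is not archimedean.  `holCotForms ιinf Kc = weightForms ⊓ {Kc-invariant} ⊓ smoothFun ⊓ holGerms ιinf` (★ `mem_holCotForms_iff`)
and `weightForms = {left U(H)(L⁺)-invariant} ∩ {K_∞-type τ along ιinf}` (★ `WeightForms.mem_iff`); for theta pairs
* LEFT `U(H)(L⁺)`-INVARIANCE is automatic (★ `lineThetaLiftFun_transport_mul_left`: the transport carries rational points to rational points), and
* FINITE-ADELIC SMOOTHNESS (`smoothFun`) is automatic: every theta pair is a value `θ_φ (mk Φ_f)` of the `ρ(a,χ)`-EQUIVARIANT `θ_φ`, and `ρ(a,χ) =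
  rhoAtLine … ιV a χ` is SMOOTH (★ `F0P2cStubCI.rhoAtLine_chi_isSmoothRep`, [Liu2021, Def. 4.11]) — an equivariant image of a smooth vector is fixed by an
  open subgroup (§1 `mem_smoothFun_of_equivariant_of_isSmoothRep`, generic).
What remains of (T∀) is ARCHIMEDEAN: (W) the `K_∞`-type `τ = weightOf x₀` along `cmArchSection`, (K) invariance under the compact factor `cmCompactFactor`,
(H) holomorphic germs along `cmArchSection` (resp. their conjugates for the antiholomorphic type) — [KonnoKonno2007, Thm 5.4] ∕ [Liu2021, Lem. D.2] content.
THEOREMS ONLY; `--supports stmt-HodgeConjecture-24833`.  HONEST LABEL: HC_CM is proved only modulo the printed citations until rung 0 closes; this file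
closes NO print letter and asserts nothing of [Liu2021].

## What is proved
* §1 (generic `adelicGroupData F E c N J`) **`mem_smoothFun_of_equivariant_of_isSmoothRep`** — a `σ`-equivariant (for right translation) linear map from a
  SMOOTH `σ` (`IsSmoothRep`) takes values in `smoothFun`.
* §2 (the OCC♭∀ frame, `N = 3`, pinned `ιV`; theta data `hρ`, `[CompactSpace [U(diag dV)]]`, `μW`, `φ : Fin 2 → 𝓢`, `χ`):
  `thetaPair_mul_left` (left invariance), **`forall_thetaPair_mem_smoothFun`** (every theta pair ∈ `smoothFun`),
  **`thetaPair_mem_holCotForms_of_arch`** ((W)+(K)+(H) ⟹ the theta pair ∈ `holCotForms … (cmArchSection …) (cmCompactFactor …)`),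
  **`thetaPair_mem_map_conjFun_holCotForms_of_arch`** ((W̄)+(K)+(H̄) on the conjugate pair ⟹ the theta pair ∈ `(holCotForms …).map conjFun`).
* §3 **`exists_ne_zero_forall_mem_cohForms_thetaFunIntertwiner_of_hol_arch`** ∕ **`…_of_antihol_arch`** — (W)(K)(H) for EVERY `Φ_f` + (N) one theta pair
  `≠ 0` ⟹ `∃ θ : omegaAtLine … a χ →ₗ[ℂ] (U(H)(𝔸_{L⁺}) → ℂ²), θ ≠ 0 ∧ (∀ w, θ w ∈ cohForms …) ∧ ∀ k w, θ (rhoAtLine … ιV a χ k w) = fun x ↦ θ w (x * k_𝔸)` —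
  the `∃ θ`-clause of `StubThetaOccursInGen` token for token (values even in `holCotForms`, resp. its conjugate).
⇒ Θ-OCC-GEN ⟸ «for every admissible `(a, χ)`: theta data `(hρ, μW, φ₀, φ₁)` whose theta pairs satisfy the ARCHIMEDEAN conditions (W)(K)(H) (or their
conjugates) for every `Φ_f`, and ONE theta pair ≠ 0».

## References
* [Liu2021] Y. Liu, *Fourier–Jacobi cycles and arithmetic relative trace formula*, Camb. J. Math. 9 (2021) = arXiv:2102.11518, Prop. 4.13 («Conversely»
  l. 2145–2149); Def. 4.11 (l. 2090–2096, smoothness); App. D §D.1 Step 3, Lem. D.2.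
* [KonnoKonno2007] T. Konno, K. Konno, Kyushu J. Math. 61 (2007), Thm 5.4 (the `K`-types of the oscillator representation of `U(2,1) × U(1)`).
* [BorelJacquet1979] A. Borel, H. Jacquet, PSPM 33.1 (1979), §4.1, §4.2 (left invariance, right `K`-finiteness, `K_∞`-type).
* [BernsteinZelevinsky1976] I. N. Bernstein, A. V. Zelevinsky, Russian Math. Surveys 31 (1976), §2.1 (smooth representations).
* [Borel1997] A. Borel, *Automorphic forms on SL₂(ℝ)*, §5.14 (holomorphy read on the group).  [BorelWallach2000] VII 2.10, 3.2.
-/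

set_option autoImplicit false

-- the mandated namespace has the single-problem summit's repeated segment (`HodgeConjecture.HodgeConjecture`)
set_option linter.dupNamespace false

noncomputable section

open NumberField MeasureTheory IsDedekindDomain MulAction
open scoped Matrix Kronecker ComplexOrder ENNReal SchwartzMap TensorProduct Classical

namespace Summit.HodgeConjecture.HodgeConjecture.Cruxes.H413.F0P2sThetaPairsCotForms

open Literature.NumberTheory.Automorphic Literature.NumberTheory.Automorphic.UnitaryGroup
open Literature.NumberTheory.Automorphic.UnitaryGroup.CotangentForms
open Literature.NumberTheory.Automorphic.IdeleClassGroup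
open Literature.NumberTheory.Automorphic.Liu2021
open Literature.NumberTheory.Automorphic.Liu2021.Def411WeilCarriers
open Literature.NumberTheory.Automorphic.Liu2021.Def411WeilCarriersDoubling
open Literature.NumberTheory.GelbartRogawski1991 Literature.NumberTheory.GelbartRogawski1991.UnitaryDualPair
open Literature.NumberTheory.GelbartRogawski1991.UnitaryDualPair.WeilCoinv
open Literature.NumberTheory.Weil1964
open Literature.RepresentationTheory Literature.RepresentationTheory.Liu2021
open Literature.RepresentationTheory.CompactGroups
open Literature.AlgebraicGeometry.ShimuraVarieties (BallForms.isPullbackCocycle_cotangentCocycle)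
open Literature.Geometry.ComplexHyperbolic.BallModel (U21 x₀)
open Summit.HodgeConjecture.HodgeConjecture.Cruxes.H413
open Summit.HodgeConjecture.HodgeConjecture.Cruxes.H413.F0P2sThetaFunIntertwiner
open Summit.HodgeConjecture.HodgeConjecture.Cruxes.H413.F0P2sThetaOccursInOfPairs

/-! ## §1 An equivariant image of a smooth representation lies in `smoothFun` (generic unitary datum) -/

section Generic

variable {F E : Type} [Field F] [NumberField F] [Field E] [NumberField E] [Algebra F E]
  {c : E ≃ₐ[F] E} {N : ℕ} {J : Matrix (Fin N) (Fin N) E}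

/-- **Finite-adelic smoothness is inherited through an equivariant map.**  If `σ` is a SMOOTH representation of `U(J)(𝔸_{F,f})` (every vector fixed by
an open subgroup, `IsSmoothRep`, [Liu2021, Def. 4.11]; [BernsteinZelevinsky1976, §2.1]) and `θ : W →ₗ[ℂ] (U(J)(𝔸_F) → ℂ²)` intertwines `σ` with right
translation (`θ (σ g w) = fun x ↦ θ w (x * g_𝔸)`), then every value `θ w` is fixed by an open subgroup of `U(J)(𝔸_{F,f})`, i.e. lies in `smoothFun`.
[cite: BorelJacquet1979, §4.2] [cite: BernsteinZelevinsky1976, §2.1] [cite: Liu2021, Def. 4.11 (l. 2096)] -/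
theorem mem_smoothFun_of_equivariant_of_isSmoothRep {W : Type} [AddCommGroup W] [Module ℂ W]
    (σ : Representation ℂ (finAdelic F E c N J) W) (hσ : IsSmoothRep σ)
    (θ : W →ₗ[ℂ] ((adelicGroupData F E c N J).Adelic → (Fin 2 → ℂ)))
    (heq : ∀ (g : finAdelic F E c N J) (w : W), θ (σ g w) = fun x => θ w (x * finAdelicToAdelic F E c N J g)) (w : W) :
    θ w ∈ smoothFun F E c N J := by
  obtain ⟨S, hSo, hS⟩ := hσ w
  refine Submodule.mem_iSup_of_mem S (Submodule.mem_iSup_of_mem hSo ?_)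
  rw [Representation.mem_invariants]
  rintro ⟨k, hk⟩
  change (fun x => θ w (x * finAdelicToAdelic F E c N J k)) = θ w
  rw [← heq k w, hS k hk]

end Generic

/-! ## §2 Theta pairs in the OCC♭∀ frame: left invariance, smoothness, and `holCotForms` from archimedean conditions -/

section Frame

variable (L : Type) [Field L] [NumberField L] [IsCMField L] (ι : L →+* ℂ) (H : Matrix (Fin 3) (Fin 3) L) (T : GL (Fin 3) ℂ)
  (hT : (T : Matrix (Fin 3) (Fin 3) ℂ)ᴴ * H.map ι * (T : Matrix (Fin 3) (Fin 3) ℂ) = Literature.Geometry.ComplexHyperbolic.BallModel.J)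
  {n' : ℕ} (e₁ : Fin 3 × Fin 1 ≃ Fin n') (dV : Fin 3 → L) (hdV : ∀ i, IsCMField.complexConj L (dV i) = dV i)
  (hdV0 : ∀ i, dV i ≠ 0) (g : GL (Fin 3) L)
  (hg : ((g : Matrix (Fin 3) (Fin 3) L).map (cmConjRingHom L))ᵀ * H * (g : Matrix (Fin 3) (Fin 3) L) = Matrix.diagonal dV)
  (ιV : finAdelic (↥(maximalRealSubfield L)) L (IsCMField.complexConj L) 3 H →*
    finAdelic (↥(maximalRealSubfield L)) L (IsCMField.complexConj L) 3 (Matrix.diagonal dV))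
  (hιV : ∀ k, ((ιV k : finAdelic (↥(maximalRealSubfield L)) L (IsCMField.complexConj L) 3 (Matrix.diagonal dV)) :
        GL (Fin 3) (FiniteAdeleRing (𝓞 L) L)) =
      (toFinAdeleGL L 3 g)⁻¹ * (k : GL (Fin 3) (FiniteAdeleRing (𝓞 L) L)) * toFinAdeleGL L 3 g)
  (μ : Literature.NumberTheory.Automorphic.IdeleClassGroup L →ₜ* Circle) (hμ : IsConjugateSymplectic L μ) (a : (↥(maximalRealSubfield L))ˣ)
  (χ : Chi (↥(maximalRealSubfield L)) L (IsCMField.complexConj L))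
  (hρ : HasThetaMajorants fun
      (p : ↥(UnitaryGroup.adelic (↥(maximalRealSubfield L)) L (IsCMField.complexConj L) 3 (Matrix.diagonal dV)) × ↥(UnitaryGroup.adelic (↥(maximalRealSubfield L)) L (IsCMField.complexConj L) 1 (JW (↥(maximalRealSubfield L)) L a))) (Φ : piSchwartzBruhat (↥(maximalRealSubfield L)) (Fin n')) =>
        pairRep (↥(maximalRealSubfield L)) L (IsCMField.complexConj L) 3 1 e₁ (Matrix.diagonal dV) (JW (↥(maximalRealSubfield L)) L a)
          (chiSplittingLine L e₁ dV hdV hdV0 (toHeckeCharacter L μ) (isUnitary_toHeckeCharacter L μ)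
            ((isOscillatorChar_toHeckeCharacter_iff μ).mpr hμ) (TW (↥(maximalRealSubfield L)) a)
            (isUnit_det_TW (↥(maximalRealSubfield L)) a) (JW (↥(maximalRealSubfield L)) L a) (JW_eq (↥(maximalRealSubfield L)) L a))
          p Φ)
  [CompactSpace (↥(UnitaryGroup.adelic (↥(maximalRealSubfield L)) L (IsCMField.complexConj L) 3 (Matrix.diagonal dV)) ⧸ (UnitaryGroup.toAdelic (↥(maximalRealSubfield L)) L (IsCMField.complexConj L) 3 (Matrix.diagonal dV)).range)]
  [MeasurableSpace (↥(UnitaryGroup.adelic (↥(maximalRealSubfield L)) L (IsCMField.complexConj L) 1 (JW (↥(maximalRealSubfield L)) L a)) ⧸ (UnitaryGroup.toAdelic (↥(maximalRealSubfield L)) L (IsCMField.complexConj L) 1 (JW (↥(maximalRealSubfield L)) L a)).range)] [BorelSpace (↥(UnitaryGroup.adelic (↥(maximalRealSubfield L)) L (IsCMField.complexConj L) 1 (JW (↥(maximalRealSubfield L)) L a)) ⧸ (UnitaryGroup.toAdelic (↥(maximalRealSubfield L)) L (IsCMField.complexConj L) 1 (JW (↥(maximalRealSubfield L)) L a)).range)]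 (μW : Measure (↥(UnitaryGroup.adelic (↥(maximalRealSubfield L)) L (IsCMField.complexConj L) 1 (JW (↥(maximalRealSubfield L)) L a)) ⧸ (UnitaryGroup.toAdelic (↥(maximalRealSubfield L)) L (IsCMField.complexConj L) 1 (JW (↥(maximalRealSubfield L)) L a)).range)) [IsFiniteMeasure μW] [SMulInvariantMeasure ↥(UnitaryGroup.adelic (↥(maximalRealSubfield L)) L (IsCMField.complexConj L) 1 (JW (↥(maximalRealSubfield L)) L a)) (↥(UnitaryGroup.adelic (↥(maximalRealSubfield L)) L (IsCMField.complexConj L) 1 (JW (↥(maximalRealSubfield L)) L a)) ⧸ (UnitaryGroup.toAdelic (↥(maximalRealSubfield L)) L (IsCMField.complexConj L) 1 (JW (↥(maximalRealSubfield L)) L a)).range) μW]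
  (φ : Fin 2 → 𝓢(((Fin 3 × Fin 1) → NumberField.mixedEmbedding.mixedSpace ↥(maximalRealSubfield L)), ℂ))

omit [BorelSpace (↥(UnitaryGroup.adelic (↥(maximalRealSubfield L)) L (IsCMField.complexConj L) 1 (JW (↥(maximalRealSubfield L)) L a)) ⧸ (UnitaryGroup.toAdelic (↥(maximalRealSubfield L)) L (IsCMField.complexConj L) 1 (JW (↥(maximalRealSubfield L)) L a)).range)] [IsFiniteMeasure μW] [SMulInvariantMeasure ↥(UnitaryGroup.adelic (↥(maximalRealSubfield L)) L (IsCMField.complexConj L) 1 (JW (↥(maximalRealSubfield L)) L a)) (↥(UnitaryGroup.adelic (↥(maximalRealSubfield L)) L (IsCMField.complexConj L) 1 (JW (↥(maximalRealSubfield L)) L a)) ⧸ (UnitaryGroup.toAdelic (↥(maximalRealSubfield L)) L (IsCMField.complexConj L) 1 (JW (↥(maximalRealSubfield L)) L a)).range) μW] in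
/-- **Left `U(H)(L⁺)`-invariance of a theta pair** — the first conjunct of `weightForms` is automatic: `Θ(φ_j, Φ_f)(γ x) = Θ(φ_j, Φ_f)(x)` for
`γ ∈ A_G · U(H)(L⁺) = U(H)(L⁺)` (★ `lineThetaLiftFun_transport_mul_left`; `quotientSubgroup = range toAdelic`, ★ `quotientSubgroup_adelicGroupData`).
[cite: BorelJacquet1979, §4.2] -/
theorem thetaPair_mul_left (Φf : FinSB (↥(maximalRealSubfield L)) (Fin 3 × Fin 1))
    {γ : (adelicGroupData (↥(maximalRealSubfield L)) L (IsCMField.complexConj L) 3 H).Adelic}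
    (hγ : γ ∈ (adelicGroupData (↥(maximalRealSubfield L)) L (IsCMField.complexConj L) 3 H).toAdelic.range)
    (x : (adelicGroupData (↥(maximalRealSubfield L)) L (IsCMField.complexConj L) 3 H).Adelic) :
    haveI := normal_range_toAdelic_JW L a
    (fun (j : Fin 2) =>
        (lineThetaKernelDatum L 3 e₁ dV hdV hdV0 μ hμ a hρ).thetaLiftFun μW
          (piSBReindex (↥(maximalRealSubfield L)) e₁ (piSchwartzBruhatEquiv (↥(maximalRealSubfield L)) (Fin 3 × Fin 1) (φ j ⊗ₜ[ℂ] Φf)))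
          (charCM (chiQuot (↥(maximalRealSubfield L)) L (IsCMField.complexConj L) (Algebra.IsQuadraticExtension.finrank_eq_two _ L)
            (IsCMField.complexConj_ne_one (K := L)) a χ))
          ((cmAdelicFrameTransport L 3 H dV g hg) (γ * x))) =
      fun (j : Fin 2) =>
        (lineThetaKernelDatum L 3 e₁ dV hdV hdV0 μ hμ a hρ).thetaLiftFun μW
          (piSBReindex (↥(maximalRealSubfield L)) e₁ (piSchwartzBruhatEquiv (↥(maximalRealSubfield L)) (Fin 3 × Fin 1) (φ j ⊗ₜ[ℂ] Φf)))
          (charCM (chiQuot (↥(maximalRealSubfield L)) L (IsCMField.complexConj L) (Algebra.IsQuadraticExtension.finrank_eq_two _ L)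
            (IsCMField.complexConj_ne_one (K := L)) a χ))
          ((cmAdelicFrameTransport L 3 H dV g hg) x) := by
  haveI := normal_range_toAdelic_JW L a
  have hγ' : γ ∈ (adelicGroupData (↥(maximalRealSubfield L)) L (IsCMField.complexConj L) 3 H).quotientSubgroup := by
    rw [SpectrumJunction.quotientSubgroup_adelicGroupData]; exact hγ
  funext j
  exact lineThetaLiftFun_transport_mul_left L 3 H e₁ dV hdV hdV0 g hg μ hμ a hρ μW _ _ hγ' x

include hg hιV in
set_option synthInstance.maxHeartbeats 400000 in
set_option maxHeartbeats 4000000 in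
/-- **Every theta pair is a SMOOTH VECTOR for the finite-adelic right translation** (`∈ smoothFun`): it is the value `θ_φ (mk Φ_f)` of the
`ρ(a,χ)`-equivariant theta intertwiner (★ `exists_thetaFunIntertwiner_rhoAtLine_of_coe`), and `ρ(a,χ) = rhoAtLine … ιV a χ` is smooth ([Liu2021, Def. 4.11];
★ `F0P2cStubCI.rhoAtLine_chi_isSmoothRep`), so §1 applies.  [cite: Liu2021, Def. 4.11 (l. 2096)] [cite: BorelJacquet1979, §4.2] [cite: BernsteinZelevinsky1976, §2.1] -/
theorem forall_thetaPair_mem_smoothFun (Φf : FinSB (↥(maximalRealSubfield L)) (Fin 3 × Fin 1)) :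
    haveI := normal_range_toAdelic_JW L a
    (fun (x : (adelicGroupData (↥(maximalRealSubfield L)) L (IsCMField.complexConj L) 3 H).Adelic) (j : Fin 2) =>
        (lineThetaKernelDatum L 3 e₁ dV hdV hdV0 μ hμ a hρ).thetaLiftFun μW
          (piSBReindex (↥(maximalRealSubfield L)) e₁ (piSchwartzBruhatEquiv (↥(maximalRealSubfield L)) (Fin 3 × Fin 1) (φ j ⊗ₜ[ℂ] Φf)))
          (charCM (chiQuot (↥(maximalRealSubfield L)) L (IsCMField.complexConj L) (Algebra.IsQuadraticExtension.finrank_eq_two _ L)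
            (IsCMField.complexConj_ne_one (K := L)) a χ))
          ((cmAdelicFrameTransport L 3 H dV g hg) x)) ∈
      smoothFun (↥(maximalRealSubfield L)) L (IsCMField.complexConj L) 3 H := by
  haveI := normal_range_toAdelic_JW L a
  obtain ⟨θ, hθ, heqv⟩ := exists_thetaFunIntertwiner_rhoAtLine_of_coe L 3 H e₁ dV hdV hdV0 g hg μ hμ a hρ μW φ χ ιV hιV
  rw [← hθ Φf]
  exact mem_smoothFun_of_equivariant_of_isSmoothRep _
    (F0P2cStubCI.rhoAtLine_chi_isSmoothRep L H e₁ dV hdV hdV0 g hg ιV hιV μ hμ a χ) θ heqv _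

include hg hιV in
set_option synthInstance.maxHeartbeats 400000 in
set_option maxHeartbeats 4000000 in
/-- **A theta pair is a HOLOMORPHIC COTANGENT FORM as soon as its ARCHIMEDEAN behaviour is right** — (W) `K_∞`-type `τ = weightOf x₀` along
`cmArchSection` on `Stab_{U(2,1)}(x₀)`, (K) right-invariance under the compact factor `cmCompactFactor`, (H) holomorphic germs along `cmArchSection`;
left invariance (★ `thetaPair_mul_left`) and finite-adelic smoothness (★ `forall_thetaPair_mem_smoothFun`) are supplied here (★ `mem_holCotForms_iff`).
[cite: Borel1997, §5.14] [cite: BorelWallach2000, VII 2.10 and 3.6] [cite: BorelJacquet1979, §4.2] [cite: KonnoKonno2007, Thm 5.4] -/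
theorem thetaPair_mem_holCotForms_of_arch (Φf : FinSB (↥(maximalRealSubfield L)) (Fin 3 × Fin 1))
    (hW : haveI := normal_range_toAdelic_JW L a
      ∀ (k : ↥(stabilizer (↥U21) x₀)) (x : (adelicGroupData (↥(maximalRealSubfield L)) L (IsCMField.complexConj L) 3 H).Adelic),
        (fun (j : Fin 2) =>
            (lineThetaKernelDatum L 3 e₁ dV hdV hdV0 μ hμ a hρ).thetaLiftFun μW
              (piSBReindex (↥(maximalRealSubfield L)) e₁ (piSchwartzBruhatEquiv (↥(maximalRealSubfield L)) (Fin 3 × Fin 1) (φ j ⊗ₜ[ℂ] Φf)))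
              (charCM (chiQuot (↥(maximalRealSubfield L)) L (IsCMField.complexConj L) (Algebra.IsQuadraticExtension.finrank_eq_two _ L)
                (IsCMField.complexConj_ne_one (K := L)) a χ))
              ((cmAdelicFrameTransport L 3 H dV g hg) (x * ((cmArchSection L ι H T hT).comp (stabilizer (↥U21) x₀).subtype) k))) =
          (BallForms.isPullbackCocycle_cotangentCocycle.weightOf x₀) k⁻¹ (fun (j : Fin 2) =>
            (lineThetaKernelDatum L 3 e₁ dV hdV hdV0 μ hμ a hρ).thetaLiftFun μW
              (piSBReindex (↥(maximalRealSubfield L)) e₁ (piSchwartzBruhatEquiv (↥(maximalRealSubfield L)) (Fin 3 × Fin 1) (φ j ⊗ₜ[ℂ] Φf)))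
              (charCM (chiQuot (↥(maximalRealSubfield L)) L (IsCMField.complexConj L) (Algebra.IsQuadraticExtension.finrank_eq_two _ L)
                (IsCMField.complexConj_ne_one (K := L)) a χ))
              ((cmAdelicFrameTransport L 3 H dV g hg) x)))
    (hK : haveI := normal_range_toAdelic_JW L a
      ∀ k ∈ cmCompactFactor L ι H T hT, ∀ (x : (adelicGroupData (↥(maximalRealSubfield L)) L (IsCMField.complexConj L) 3 H).Adelic),
        (fun (j : Fin 2) =>
            (lineThetaKernelDatum L 3 e₁ dV hdV hdV0 μ hμ a hρ).thetaLiftFun μW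
              (piSBReindex (↥(maximalRealSubfield L)) e₁ (piSchwartzBruhatEquiv (↥(maximalRealSubfield L)) (Fin 3 × Fin 1) (φ j ⊗ₜ[ℂ] Φf)))
              (charCM (chiQuot (↥(maximalRealSubfield L)) L (IsCMField.complexConj L) (Algebra.IsQuadraticExtension.finrank_eq_two _ L)
                (IsCMField.complexConj_ne_one (K := L)) a χ))
              ((cmAdelicFrameTransport L 3 H dV g hg) (x * k))) =
          fun (j : Fin 2) =>
            (lineThetaKernelDatum L 3 e₁ dV hdV hdV0 μ hμ a hρ).thetaLiftFun μW
              (piSBReindex (↥(maximalRealSubfield L)) e₁ (piSchwartzBruhatEquiv (↥(maximalRealSubfield L)) (Fin 3 × Fin 1) (φ j ⊗ₜ[ℂ] Φf)))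
              (charCM (chiQuot (↥(maximalRealSubfield L)) L (IsCMField.complexConj L) (Algebra.IsQuadraticExtension.finrank_eq_two _ L)
                (IsCMField.complexConj_ne_one (K := L)) a χ))
              ((cmAdelicFrameTransport L 3 H dV g hg) x))
    (hH : haveI := normal_range_toAdelic_JW L a
      IsHolGerm (cmArchSection L ι H T hT) (fun (x : (adelicGroupData (↥(maximalRealSubfield L)) L (IsCMField.complexConj L) 3 H).Adelic) (j : Fin 2) =>
        (lineThetaKernelDatum L 3 e₁ dV hdV hdV0 μ hμ a hρ).thetaLiftFun μW
          (piSBReindex (↥(maximalRealSubfield L)) e₁ (piSchwartzBruhatEquiv (↥(maximalRealSubfield L)) (Fin 3 × Fin 1) (φ j ⊗ₜ[ℂ] Φf)))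
          (charCM (chiQuot (↥(maximalRealSubfield L)) L (IsCMField.complexConj L) (Algebra.IsQuadraticExtension.finrank_eq_two _ L)
            (IsCMField.complexConj_ne_one (K := L)) a χ))
          ((cmAdelicFrameTransport L 3 H dV g hg) x))) :
    haveI := normal_range_toAdelic_JW L a
    (fun (x : (adelicGroupData (↥(maximalRealSubfield L)) L (IsCMField.complexConj L) 3 H).Adelic) (j : Fin 2) =>
        (lineThetaKernelDatum L 3 e₁ dV hdV hdV0 μ hμ a hρ).thetaLiftFun μW
          (piSBReindex (↥(maximalRealSubfield L)) e₁ (piSchwartzBruhatEquiv (↥(maximalRealSubfield L)) (Fin 3 × Fin 1) (φ j ⊗ₜ[ℂ] Φf)))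
          (charCM (chiQuot (↥(maximalRealSubfield L)) L (IsCMField.complexConj L) (Algebra.IsQuadraticExtension.finrank_eq_two _ L)
            (IsCMField.complexConj_ne_one (K := L)) a χ))
          ((cmAdelicFrameTransport L 3 H dV g hg) x)) ∈
      holCotForms (↥(maximalRealSubfield L)) L (IsCMField.complexConj L) 3 H (cmArchSection L ι H T hT) (cmCompactFactor L ι H T hT) := by
  haveI := normal_range_toAdelic_JW L a
  refine mem_holCotForms_iff.mpr ⟨⟨fun γ hγ x => ?_, hW⟩, hK, ?_, hH⟩
  · exact thetaPair_mul_left L H e₁ dV hdV hdV0 g hg μ hμ a χ hρ μW φ Φf hγ x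
  · exact forall_thetaPair_mem_smoothFun L H e₁ dV hdV hdV0 g hg ιV hιV μ hμ a χ hρ μW φ Φf

include hg hιV in
set_option synthInstance.maxHeartbeats 400000 in
set_option maxHeartbeats 4000000 in
/-- **Antiholomorphic twin**: if the CONJUGATE pair `conjFun (theta pair)` satisfies (W)+(K)+(H) (i.e. the theta pair has `K_∞`-type `τ̄`, is `K_c`-invariant
and has ANTIholomorphic germs), then the theta pair lies in `(holCotForms …).map conjFun` — the carrier of `IsAntiholCotangentAt` (left invariance and smoothness
again for free; ★ `conjFun_mem_smoothFun`, ★ `conjFun_conjFun`).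
[cite: BorelWallach2000, VII 2.10] [cite: Borel1997, §5.14] [cite: BorelJacquet1979, §4.2] [cite: KonnoKonno2007, Thm 5.4] -/
theorem thetaPair_mem_map_conjFun_holCotForms_of_arch (Φf : FinSB (↥(maximalRealSubfield L)) (Fin 3 × Fin 1))
    (hW : haveI := normal_range_toAdelic_JW L a
      ∀ (k : ↥(stabilizer (↥U21) x₀)) (x : (adelicGroupData (↥(maximalRealSubfield L)) L (IsCMField.complexConj L) 3 H).Adelic),
        conjFun (↥(maximalRealSubfield L)) L (IsCMField.complexConj L) 3 H (fun (x : (adelicGroupData (↥(maximalRealSubfield L)) L (IsCMField.complexConj L) 3 H).Adelic) (j : Fin 2) =>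
            (lineThetaKernelDatum L 3 e₁ dV hdV hdV0 μ hμ a hρ).thetaLiftFun μW
              (piSBReindex (↥(maximalRealSubfield L)) e₁ (piSchwartzBruhatEquiv (↥(maximalRealSubfield L)) (Fin 3 × Fin 1) (φ j ⊗ₜ[ℂ] Φf)))
              (charCM (chiQuot (↥(maximalRealSubfield L)) L (IsCMField.complexConj L) (Algebra.IsQuadraticExtension.finrank_eq_two _ L)
                (IsCMField.complexConj_ne_one (K := L)) a χ))
              ((cmAdelicFrameTransport L 3 H dV g hg) x)) (x * ((cmArchSection L ι H T hT).comp (stabilizer (↥U21) x₀).subtype) k) =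
          (BallForms.isPullbackCocycle_cotangentCocycle.weightOf x₀) k⁻¹
            (conjFun (↥(maximalRealSubfield L)) L (IsCMField.complexConj L) 3 H (fun (x : (adelicGroupData (↥(maximalRealSubfield L)) L (IsCMField.complexConj L) 3 H).Adelic) (j : Fin 2) =>
              (lineThetaKernelDatum L 3 e₁ dV hdV hdV0 μ hμ a hρ).thetaLiftFun μW
                (piSBReindex (↥(maximalRealSubfield L)) e₁ (piSchwartzBruhatEquiv (↥(maximalRealSubfield L)) (Fin 3 × Fin 1) (φ j ⊗ₜ[ℂ] Φf)))
                (charCM (chiQuot (↥(maximalRealSubfield L)) L (IsCMField.complexConj L) (Algebra.IsQuadraticExtension.finrank_eq_two _ L)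
                  (IsCMField.complexConj_ne_one (K := L)) a χ))
                ((cmAdelicFrameTransport L 3 H dV g hg) x)) x))
    (hK : haveI := normal_range_toAdelic_JW L a
      ∀ k ∈ cmCompactFactor L ι H T hT, ∀ (x : (adelicGroupData (↥(maximalRealSubfield L)) L (IsCMField.complexConj L) 3 H).Adelic),
        (fun (j : Fin 2) =>
            (lineThetaKernelDatum L 3 e₁ dV hdV hdV0 μ hμ a hρ).thetaLiftFun μW
              (piSBReindex (↥(maximalRealSubfield L)) e₁ (piSchwartzBruhatEquiv (↥(maximalRealSubfield L)) (Fin 3 × Fin 1) (φ j ⊗ₜ[ℂ] Φf)))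
              (charCM (chiQuot (↥(maximalRealSubfield L)) L (IsCMField.complexConj L) (Algebra.IsQuadraticExtension.finrank_eq_two _ L)
                (IsCMField.complexConj_ne_one (K := L)) a χ))
              ((cmAdelicFrameTransport L 3 H dV g hg) (x * k))) =
          fun (j : Fin 2) =>
            (lineThetaKernelDatum L 3 e₁ dV hdV hdV0 μ hμ a hρ).thetaLiftFun μW
              (piSBReindex (↥(maximalRealSubfield L)) e₁ (piSchwartzBruhatEquiv (↥(maximalRealSubfield L)) (Fin 3 × Fin 1) (φ j ⊗ₜ[ℂ] Φf)))
              (charCM (chiQuot (↥(maximalRealSubfield L)) L (IsCMField.complexConj L) (Algebra.IsQuadraticExtension.finrank_eq_two _ L)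
                (IsCMField.complexConj_ne_one (K := L)) a χ))
              ((cmAdelicFrameTransport L 3 H dV g hg) x))
    (hH : haveI := normal_range_toAdelic_JW L a
      IsHolGerm (cmArchSection L ι H T hT) (conjFun (↥(maximalRealSubfield L)) L (IsCMField.complexConj L) 3 H
        (fun (x : (adelicGroupData (↥(maximalRealSubfield L)) L (IsCMField.complexConj L) 3 H).Adelic) (j : Fin 2) =>
          (lineThetaKernelDatum L 3 e₁ dV hdV hdV0 μ hμ a hρ).thetaLiftFun μW
            (piSBReindex (↥(maximalRealSubfield L)) e₁ (piSchwartzBruhatEquiv (↥(maximalRealSubfield L)) (Fin 3 × Fin 1) (φ j ⊗ₜ[ℂ] Φf)))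
            (charCM (chiQuot (↥(maximalRealSubfield L)) L (IsCMField.complexConj L) (Algebra.IsQuadraticExtension.finrank_eq_two _ L)
              (IsCMField.complexConj_ne_one (K := L)) a χ))
            ((cmAdelicFrameTransport L 3 H dV g hg) x)))) :
    haveI := normal_range_toAdelic_JW L a
    (fun (x : (adelicGroupData (↥(maximalRealSubfield L)) L (IsCMField.complexConj L) 3 H).Adelic) (j : Fin 2) =>
        (lineThetaKernelDatum L 3 e₁ dV hdV hdV0 μ hμ a hρ).thetaLiftFun μW
          (piSBReindex (↥(maximalRealSubfield L)) e₁ (piSchwartzBruhatEquiv (↥(maximalRealSubfield L)) (Fin 3 × Fin 1) (φ j ⊗ₜ[ℂ] Φf)))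
          (charCM (chiQuot (↥(maximalRealSubfield L)) L (IsCMField.complexConj L) (Algebra.IsQuadraticExtension.finrank_eq_two _ L)
            (IsCMField.complexConj_ne_one (K := L)) a χ))
          ((cmAdelicFrameTransport L 3 H dV g hg) x)) ∈
      (holCotForms (↥(maximalRealSubfield L)) L (IsCMField.complexConj L) 3 H (cmArchSection L ι H T hT) (cmCompactFactor L ι H T hT)).map
        (conjFun (↥(maximalRealSubfield L)) L (IsCMField.complexConj L) 3 H) := by
  haveI := normal_range_toAdelic_JW L a
  refine Submodule.mem_map.mpr ⟨_, mem_holCotForms_iff.mpr ⟨⟨fun γ hγ x => ?_, hW⟩, fun k hk x => ?_, ?_, hH⟩, conjFun_conjFun _⟩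
  · -- left invariance of the conjugate pair
    simp only [conjFun_apply]
    rw [thetaPair_mul_left L H e₁ dV hdV hdV0 g hg μ hμ a χ hρ μW φ Φf hγ x]
  · -- `K_c`-invariance of the conjugate pair
    simp only [conjFun_apply]
    rw [hK k hk x]
  · -- smoothness of the conjugate pair
    exact conjFun_mem_smoothFun (forall_thetaPair_mem_smoothFun L H e₁ dV hdV hdV0 g hg ιV hιV μ hμ a χ hρ μW φ Φf)

end Frame

end Summit.HodgeConjecture.HodgeConjecture.Cruxes.H413.F0P2sThetaPairsCotForms

end
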